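import Mathlib
import Literature.NumberTheory.GaloisRepresentations.CrystallineOrdinaryShape
import Literature.NumberTheory.GaloisRepresentations.LocalKroneckerWeberInertiaProofs
import Literature.NumberTheory.Automorphic.AdicCompletionLocalField
import Literature.NumberTheory.EllipticCurves.TorsionFrobeniusProofs
import Summits.Langlands.Langlands.Theorems.PhantomRMYoshidaStableYoshidaCongruenceCharpolyCongruence

/-!
# Route `PhantomRMYoshida`, crux `StableYoshidaCongruence` (stmt-Langlands-13640), line
# `level-three-weierstrass-switch`: Stub 1b `stub_distinguishedTransferLocal`

`p` odd, `v ∣ p`, `r, r' : Γ_ℚ → GL₄(ℚ̄_p)` with congruent characteristic polynomials everywhere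
(Stub 1a, `…Theorems/PhantomRMYoshidaStableYoshidaCongruenceCharpolyCongruence.lean`); `r`
residually distinguished of shape `(0,0,1,1)` at `v`, `r'` Greenberg-ordinary of shape `(0,0,1,1)`
at `v` ⇒ `r'` residually distinguished of shape `(0,0,1,1)` at `v`, in its Greenberg frame
(registered signature). Proof WITHOUT Brauer–Nesbitt: (I) pairwise DISTINCT monoid homs `χᵢ : G →*
L` with the same pointwise sum as arbitrary `ψᵢ` force `ψ` to be a rearrangement of `χ`
(`MonoidHom.injective_of_sum_eq`: Dedekind `linearIndependent_monoidHom` + the count "a multiplicity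
`≡ 1 (mod char L)` is non-zero, both sides sum to `#ι`"), and `Σᵢ (g M g⁻¹)ᵢᵢ = -(charpoly M).coeff
n` for ANY frame `g`; (II) in the tree's `FramedRep.IsUpperTriangular` vocabulary over any compact
`G`: diagonal entries lie in `𝒪`, residual diagonal characters exist as monoid homs
(`exists_resDiagChar`), `χ̄ᵢ(τ) ≠ χ̄ⱼ(τ) ⟺ ‖χᵢ(τ) - χⱼ(τ)‖ = 1` (`ker red = 𝔪`, landed 1a lemmas),
the trace route `Σᵢ χᵢ(τ) = -P.coeff 3` gives equal residual traces, the four `χ̄ᵢ` of a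
distinguished frame are pairwise distinct given ONE element with diagonal `(1,1,u,u)`, `‖u-1‖ = 1`,
whence the core `residuallyDistinguished_transfer_core`; (III) unpack the frames (`…_iff_conj`),
restrict the congruence to `Γ_{ℚ_v}` (`toLocal`, rfl), take inertia `ι` with `ε_loc(ι) = -1`
(`adicCompletion_rat_exists_mem_absInertia_cyclotomicCharacter_eq`; `‖-1-1‖ = ‖2‖_p = 1`, the only
use of `p ≠ 2`), apply the core, repack. Everything used is proved in the tree; no named fact is a
hypothesis; no new definition.
-/

open Finset

-- `Summit.Langlands.Langlands.…` (summit = sub-problem name, D-0017 layout) trips `dupNamespace`.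
set_option linter.dupNamespace false

namespace Summit.Langlands.Langlands.Cruxes.StableYoshidaCongruence.LevelThreeWeierstrassSwitch

namespace MonoidHom

variable {ι G L : Type*} [Fintype ι] [MulOneClass G] [CommRing L] [IsDomain L]

/-- **Multiplicity comparison from a trace identity.**  Pairwise distinct `χ i : G →* L` (any monoid,
any domain) and arbitrary `ψ i` with `∑ i, χ i g = ∑ i, ψ i g` for all `g`: every `f : G →* L` occurs
among the `ψ i` exactly as often as among the `χ i` (`0` or `1` times). [folklore] -/
theorem card_filter_eq_of_sum_eq [DecidableEq (G →* L)] (χ ψ : ι → (G →* L))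
    (hχ : Function.Injective χ) (h : ∀ g, ∑ i, χ i g = ∑ i, ψ i g) (f : G →* L) :
    #{i | ψ i = f} = #{i | χ i = f} := by
  classical
  set S : Finset (G →* L) := univ.image χ ∪ univ.image ψ with hS
  have hχS : ∀ i ∈ (univ : Finset ι), χ i ∈ S := fun i _ => by simp [hS]
  have hψS : ∀ i ∈ (univ : Finset ι), ψ i ∈ S := fun i _ => by simp [hS]
  set a : (G →* L) → ℕ := fun f => #{i | χ i = f} with ha
  set b : (G →* L) → ℕ := fun f => #{i | ψ i = f} with hb
  have hsum : ∀ θ : ι → (G →* L), (∀ i ∈ (univ : Finset ι), θ i ∈ S) →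
      ∑ f ∈ S, (#{i | θ i = f} : L) • (f : G → L) = ∑ i, (θ i : G → L) := fun θ hθ => by
    rw [← sum_fiberwise_of_maps_to hθ]
    refine sum_congr rfl fun f _ => ?_
    rw [sum_congr rfl fun i hi => by rw [(mem_filter.1 hi).2], sum_const, ← Nat.cast_smul_eq_nsmul L]
  have hrel : ∑ f ∈ S, ((a f : L) - (b f : L)) • (f : G → L) = 0 := by
    have hsumχ : ∑ f ∈ S, (a f : L) • (f : G → L) = ∑ i, (χ i : G → L) := hsum χ hχS
    have hsumψ : ∑ f ∈ S, (b f : L) • (f : G → L) = ∑ i, (ψ i : G → L) := hsum ψ hψS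
    simp only [sub_smul, sum_sub_distrib, hsumχ, hsumψ, sub_eq_zero]
    ext g
    simpa [Finset.sum_apply] using h g
  have hcoef : ∀ f ∈ S, (a f : L) = (b f : L) := fun f hf =>
    sub_eq_zero.1 (linearIndependent_iff'.1 (linearIndependent_monoidHom G L) S _ hrel f hf)
  have ha1 : ∀ f, a f ≤ 1 := fun f =>
    card_le_one.2 fun x hx y hy => hχ ((mem_filter.1 hx).2.trans (mem_filter.1 hy).2.symm)
  have hab : ∀ f ∈ S, a f ≤ b f := by
    intro f hf
    rcases Nat.le_one_iff_eq_zero_or_eq_one.1 (ha1 f) with h0 | h1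
    · rw [h0]; exact Nat.zero_le _
    · rw [h1, Nat.one_le_iff_ne_zero]
      intro hb0
      have := hcoef f hf
      rw [h1, hb0, Nat.cast_one, Nat.cast_zero] at this
      exact one_ne_zero this
  have heqS : ∀ f ∈ S, a f = b f := (sum_eq_sum_iff_of_le hab).1
    ((card_eq_sum_card_fiberwise hχS).symm.trans (card_eq_sum_card_fiberwise hψS))
  by_cases hf : f ∈ S
  · exact (heqS f hf).symm
  · have hbf : b f = 0 := card_eq_zero.2 (filter_eq_empty_iff.2 fun i _ hif =>
      hf (hif ▸ hψS i (mem_univ i)))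
    have haf : a f = 0 := card_eq_zero.2 (filter_eq_empty_iff.2 fun i _ hif =>
      hf (hif ▸ hχS i (mem_univ i)))
    change b f = a f
    rw [hbf, haf]

/-- **Distinct characters with the same trace sum are a rearrangement**: the `ψ i` are pairwise
distinct and each `ψ i` is some `χ j`. [folklore] -/
theorem injective_of_sum_eq (χ ψ : ι → (G →* L)) (hχ : Function.Injective χ)
    (h : ∀ g, ∑ i, χ i g = ∑ i, ψ i g) :
    Function.Injective ψ ∧ ∀ i, ∃ j, ψ i = χ j := by
  classical
  have hmult := card_filter_eq_of_sum_eq χ ψ hχ h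
  have hle1 : ∀ f, #{i | χ i = f} ≤ 1 := fun f =>
    card_le_one.2 fun x hx y hy => hχ ((mem_filter.1 hx).2.trans (mem_filter.1 hy).2.symm)
  refine ⟨fun i i' hii' => ?_, fun i => ?_⟩
  · -- two indices with the same `ψ`-value would give multiplicity ≥ 2 > 1
    by_contra hne
    have h2 : 2 ≤ #{j | ψ j = ψ i} := by
      have hsub : ({i, i'} : Finset ι) ⊆ ({j | ψ j = ψ i} : Finset ι) := by
        intro x hx
        rcases mem_insert.1 hx with rfl | hx
        · simp
        · rw [mem_singleton.1 hx]; simp [hii']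
      simpa [card_pair hne] using card_le_card hsub
    have := (hmult (ψ i)) ▸ h2
    exact absurd (this.trans (hle1 (ψ i))) (by norm_num)
  · -- `ψ i` occurs among the `ψ`'s, hence among the `χ`'s
    have h1 : 1 ≤ #{j | ψ j = ψ i} := card_pos.2 ⟨i, by simp⟩
    rw [hmult (ψ i)] at h1
    obtain ⟨j, hj⟩ := card_pos.1 h1
    exact ⟨j, ((mem_filter.1 hj).2).symm⟩

end MonoidHom

/-- **Trace route.**  For ANY frame `g`, the sum of the diagonal entries of `g M g⁻¹` is minus the
sub-leading coefficient of `charpoly M` (`Matrix.trace_mul_cycle` + `Matrix.trace_eq_neg_charpoly_coeff`). [folklore] -/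
theorem Matrix.sum_diag_units_conj_eq_neg_charpoly_coeff {R : Type*} [CommRing R] {n : ℕ}
    (g : GL (Fin (n + 1)) R) (M : Matrix (Fin (n + 1)) (Fin (n + 1)) R) :
    ∑ i, ((g : Matrix (Fin (n + 1)) (Fin (n + 1)) R) * M *
        ((g⁻¹ : GL (Fin (n + 1)) R) : Matrix (Fin (n + 1)) (Fin (n + 1)) R)) i i =
      -(M.charpoly.coeff n) := by
  have h1 : ((g : Matrix (Fin (n + 1)) (Fin (n + 1)) R) * M *
      ((g⁻¹ : GL (Fin (n + 1)) R) : Matrix (Fin (n + 1)) (Fin (n + 1)) R)).trace = M.trace := by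
    rw [Matrix.trace_mul_cycle, Units.inv_mul, one_mul]
  have h2 := Matrix.trace_eq_neg_charpoly_coeff M
  rw [Fintype.card_fin, Nat.add_sub_cancel] at h2
  rw [← h2, ← h1, Matrix.trace]
  rfl

/-! ## Part II — framed-representation glue (tree vocabulary; no new definitions) -/

open Literature.NumberTheory.GaloisRepresentations

variable {G : Type*} [Group G] [TopologicalSpace G] [CompactSpace G] {p : ℕ} [Fact p.Prime] {n : ℕ}
  {ρ : FramedRep G (PadicAlgCl p) n}

/-- The diagonal entries of an upper-triangular frame of a compact group lie in the valuation ring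
`𝒪 = {‖x‖ ≤ 1}` of `ℚ̄_p` (norm one, `norm_diagEntry_eq_one`). [folklore] -/
theorem diagEntry_mem_integer (h : ρ.IsUpperTriangular) (i : Fin n) (g : G) :
    ρ.diagEntry i g ∈ Valued.integer (PadicAlgCl p) :=
  PadicAlgCl.mem_integer_of_norm_le_one (h.norm_diagEntry_eq_one i g).le

variable {k : Type} [Field k]

/-- **The residual diagonal characters exist as monoid homomorphisms** `χ̄ᵢ = red ∘ χᵢ : G →* k`
(`χᵢ` the `i`-th diagonal entry, multiplicative for a triangular frame, `diagEntry_mul`). [folklore] -/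
theorem exists_resDiagChar (h : ρ.IsUpperTriangular) (red : Valued.integer (PadicAlgCl p) →+* k) :
    ∃ χ : Fin n → (G →* k),
      ∀ i g, χ i g = red ⟨ρ.diagEntry i g, diagEntry_mem_integer h i g⟩ := by
  have mk : ∀ i : Fin n, ∃ χ : G →* k,
      ∀ g, χ g = red ⟨ρ.diagEntry i g, diagEntry_mem_integer h i g⟩ := by
    intro i
    refine ⟨{ toFun := fun g => red ⟨ρ.diagEntry i g, diagEntry_mem_integer h i g⟩
              map_one' := ?_
              map_mul' := ?_ }, fun g => rfl⟩
    · show red ⟨ρ.diagEntry i 1, _⟩ = 1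
      have e : (⟨ρ.diagEntry i 1, diagEntry_mem_integer h i 1⟩ : Valued.integer (PadicAlgCl p)) = 1 :=
        Subtype.ext (ρ.diagEntry_one i)
      rw [e, map_one]
    · intro g g'
      show red ⟨ρ.diagEntry i (g * g'), _⟩ = red ⟨ρ.diagEntry i g, _⟩ * red ⟨ρ.diagEntry i g', _⟩
      rw [← map_mul]
      exact congrArg red (Subtype.ext (h.diagEntry_mul i g g'))
  choose χ hχ using mk
  exact ⟨χ, hχ⟩

variable [CharP k p]

/-- **Residual inequality is the norm-one condition** (`ker red = 𝔪`): `χ̄ᵢ(τ) ≠ χ̄ⱼ(τ)` iff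
`‖χᵢ(τ) - χⱼ(τ)‖ = 1` — the clause of `IsResiduallyDistinguishedOfShape`. [folklore] -/
theorem red_diagEntry_ne_iff (h : ρ.IsUpperTriangular) (red : Valued.integer (PadicAlgCl p) →+* k)
    (i j : Fin n) (τ : G) :
    red ⟨ρ.diagEntry i τ, diagEntry_mem_integer h i τ⟩ ≠
        red ⟨ρ.diagEntry j τ, diagEntry_mem_integer h j τ⟩ ↔
      ‖ρ.diagEntry i τ - ρ.diagEntry j τ‖ = 1 := by
  set a : Valued.integer (PadicAlgCl p) := ⟨ρ.diagEntry i τ, diagEntry_mem_integer h i τ⟩ with ha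
  set b : Valued.integer (PadicAlgCl p) := ⟨ρ.diagEntry j τ, diagEntry_mem_integer h j τ⟩ with hb
  have hcoe : (((a - b : Valued.integer (PadicAlgCl p)) : PadicAlgCl p)) =
      ρ.diagEntry i τ - ρ.diagEntry j τ := by
    rw [AddSubgroupClass.coe_sub]
  have key : red (a - b) = 0 ↔ ‖ρ.diagEntry i τ - ρ.diagEntry j τ‖ < 1 := by
    constructor
    · intro h0
      have := norm_lt_one_of_red_eq_zero red h0
      rwa [hcoe] at this
    · intro hlt
      exact red_eq_zero_of_norm_lt_one red _ (by rwa [hcoe])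
  rw [h.norm_diagEntry_sub_eq_one_iff, ← key, map_sub, sub_eq_zero]

/-- `χ̄ᵢ ≠ χ̄ⱼ` as characters iff some `τ` has `‖χᵢ(τ) - χⱼ(τ)‖ = 1`. [folklore] -/
theorem resDiagChar_ne_iff (h : ρ.IsUpperTriangular) (red : Valued.integer (PadicAlgCl p) →+* k)
    {χ : Fin n → (G →* k)} (hχ : ∀ i g, χ i g = red ⟨ρ.diagEntry i g, diagEntry_mem_integer h i g⟩)
    (i j : Fin n) :
    χ i ≠ χ j ↔ ∃ τ, ‖ρ.diagEntry i τ - ρ.diagEntry j τ‖ = 1 := by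
  rw [Ne, MonoidHom.ext_iff, not_forall]
  refine exists_congr fun τ => ?_
  rw [hχ i τ, hχ j τ]
  exact red_diagEntry_ne_iff h red i j τ

omit [CharP k p] in
/-- **Trace route, framed form.**  For `r` upper triangular in the frame `g` and `P ∈ 𝒪[X]` the
integral lift of `charpoly r(τ)`: `Σᵢ χᵢ(τ) = -P.coeff 3` in `𝒪`. [folklore] -/
theorem sum_diagEntry_eq_neg_coeff {r : FramedRep G (PadicAlgCl p) 4} {g : GL (Fin 4) (PadicAlgCl p)}
    (h : (r.conj g).IsUpperTriangular) (τ : G) (P : Polynomial (Valued.integer (PadicAlgCl p)))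
    (hP : P.map (Valued.integer (PadicAlgCl p)).subtype = r.charpoly τ) :
    ∑ i, (⟨(r.conj g).diagEntry i τ, diagEntry_mem_integer h i τ⟩ : Valued.integer (PadicAlgCl p)) =
      -P.coeff 3 := by
  apply Subtype.ext
  have hM := Matrix.sum_diag_units_conj_eq_neg_charpoly_coeff g
    ((r τ : GL (Fin 4) (PadicAlgCl p)) : Matrix (Fin 4) (Fin 4) (PadicAlgCl p))
  have hc : (((r τ : GL (Fin 4) (PadicAlgCl p)) : Matrix (Fin 4) (Fin 4) (PadicAlgCl p))).charpoly.coeff 3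
      = ((P.coeff 3 : Valued.integer (PadicAlgCl p)) : PadicAlgCl p) := by
    change (r.charpoly τ).coeff 3 = _
    rw [← hP, Polynomial.coeff_map]
    rfl
  rw [hc] at hM
  rw [AddSubmonoidClass.coe_finsetSum, NegMemClass.coe_neg, ← hM]
  refine Finset.sum_congr rfl fun i _ => ?_
  simp only [FramedRep.diagEntry_apply, FramedRep.conj_apply, Units.val_mul]

omit [CharP k p] in
/-- **The 1a congruence gives equal residual traces** of the two triangular frames, pointwise. [folklore] -/
theorem sum_resDiagChar_eq_of_congr (red : Valued.integer (PadicAlgCl p) →+* k)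
    {r r' : FramedRep G (PadicAlgCl p) 4} {g g' : GL (Fin 4) (PadicAlgCl p)}
    (hr : (r.conj g).IsUpperTriangular) (hr' : (r'.conj g').IsUpperTriangular)
    (hcong : ∀ τ, ∃ P P' : Polynomial (Valued.integer (PadicAlgCl p)),
        P.map (Valued.integer (PadicAlgCl p)).subtype = r.charpoly τ ∧
        P'.map (Valued.integer (PadicAlgCl p)).subtype = r'.charpoly τ ∧ P.map red = P'.map red)
    {χ ψ : Fin 4 → (G →* k)}
    (hχ : ∀ i τ, χ i τ = red ⟨(r.conj g).diagEntry i τ, diagEntry_mem_integer hr i τ⟩)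
    (hψ : ∀ i τ, ψ i τ = red ⟨(r'.conj g').diagEntry i τ, diagEntry_mem_integer hr' i τ⟩)
    (τ : G) : ∑ i, χ i τ = ∑ i, ψ i τ := by
  obtain ⟨P, P', hP, hP', hPP'⟩ := hcong τ
  have e3 : red (P.coeff 3) = red (P'.coeff 3) := by
    rw [← Polynomial.coeff_map, ← Polynomial.coeff_map, hPP']
  have e : red (∑ i, (⟨(r.conj g).diagEntry i τ, diagEntry_mem_integer hr i τ⟩ :
        Valued.integer (PadicAlgCl p))) =
      red (∑ i, (⟨(r'.conj g').diagEntry i τ, diagEntry_mem_integer hr' i τ⟩ :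
        Valued.integer (PadicAlgCl p))) := by
    rw [sum_diagEntry_eq_neg_coeff hr τ P hP, sum_diagEntry_eq_neg_coeff hr' τ P' hP', map_neg,
      map_neg, e3]
  rw [map_sum, map_sum] at e
  simpa only [hχ, hψ] using e

/-- **Pairwise distinctness of the residual diagonal characters of a distinguished `(0,0,1,1)` frame**:
within-block witnesses (`(0,1)`, `(2,3)`) plus ONE element `ι` with diagonal `(1, 1, u, u)`,
`‖u - 1‖ = 1` (an inertia element with `ε(ι) = -1`, `p` odd). [folklore] -/
theorem injective_resDiagChar_of_yoshida {r : FramedRep G (PadicAlgCl p) 4}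
    (h : r.IsUpperTriangular) (red : Valued.integer (PadicAlgCl p) →+* k)
    {χ : Fin 4 → (G →* k)} (hχ : ∀ i g, χ i g = red ⟨r.diagEntry i g, diagEntry_mem_integer h i g⟩)
    (h01 : ∃ τ, ‖r.diagEntry 0 τ - r.diagEntry 1 τ‖ = 1)
    (h23 : ∃ τ, ‖r.diagEntry 2 τ - r.diagEntry 3 τ‖ = 1)
    (hι : ∃ ι : G, ∃ u : PadicAlgCl p, r.diagEntry 0 ι = 1 ∧ r.diagEntry 1 ι = 1 ∧
      r.diagEntry 2 ι = u ∧ r.diagEntry 3 ι = u ∧ ‖u - 1‖ = 1) :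
    Function.Injective χ := by
  obtain ⟨ι, u, h0, h1, h2, h3, hu⟩ := hι
  have hu' : ‖1 - u‖ = 1 := by rw [norm_sub_rev]; exact hu
  have hw : ∀ i j : Fin 4, i ≠ j → ∃ τ, ‖r.diagEntry i τ - r.diagEntry j τ‖ = 1 := by
    have hsymm : ∀ i j : Fin 4, (∃ τ, ‖r.diagEntry i τ - r.diagEntry j τ‖ = 1) →
        ∃ τ, ‖r.diagEntry j τ - r.diagEntry i τ‖ = 1 := fun i j ⟨τ, hτ⟩ => ⟨τ, by rwa [norm_sub_rev]⟩
    have h02 : ∃ τ, ‖r.diagEntry 0 τ - r.diagEntry 2 τ‖ = 1 := ⟨ι, by rw [h0, h2]; exact hu'⟩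
    have h03 : ∃ τ, ‖r.diagEntry 0 τ - r.diagEntry 3 τ‖ = 1 := ⟨ι, by rw [h0, h3]; exact hu'⟩
    have h12 : ∃ τ, ‖r.diagEntry 1 τ - r.diagEntry 2 τ‖ = 1 := ⟨ι, by rw [h1, h2]; exact hu'⟩
    have h13 : ∃ τ, ‖r.diagEntry 1 τ - r.diagEntry 3 τ‖ = 1 := ⟨ι, by rw [h1, h3]; exact hu'⟩
    intro i j hij
    fin_cases i <;> fin_cases j
    all_goals first
      | exact absurd rfl hij
      | exact h01 | exact h23 | exact h02 | exact h03 | exact h12 | exact h13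
      | exact hsymm _ _ h01 | exact hsymm _ _ h23 | exact hsymm _ _ h02 | exact hsymm _ _ h03
      | exact hsymm _ _ h12 | exact hsymm _ _ h13
  intro i j hij
  by_contra hne
  exact ((resDiagChar_ne_iff h red hχ i j).2 (hw i j hne)) hij

/-- **Stub 1b, core.**  `r, r'` upper triangular in frames `g, g'`; the coefficientwise charpoly
congruence of Stub 1a; the four residual diagonal characters `χ̄ᵢ` of `r` pairwise distinct.  Then the
two witness clauses of `IsResiduallyDistinguishedOfShape ![0,0,1,1]` hold for `r'` IN THE FRAME `g'`
(indeed all four `ψ̄ᵢ` are pairwise distinct): trace congruence + Dedekind + counting. [folklore] -/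
theorem residuallyDistinguished_transfer_core (red : Valued.integer (PadicAlgCl p) →+* k)
    {r r' : FramedRep G (PadicAlgCl p) 4} {g g' : GL (Fin 4) (PadicAlgCl p)}
    (hr : (r.conj g).IsUpperTriangular) (hr' : (r'.conj g').IsUpperTriangular)
    (hcong : ∀ τ, ∃ P P' : Polynomial (Valued.integer (PadicAlgCl p)),
        P.map (Valued.integer (PadicAlgCl p)).subtype = r.charpoly τ ∧
        P'.map (Valued.integer (PadicAlgCl p)).subtype = r'.charpoly τ ∧ P.map red = P'.map red)
    {χ ψ : Fin 4 → (G →* k)}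
    (hχ : ∀ i τ, χ i τ = red ⟨(r.conj g).diagEntry i τ, diagEntry_mem_integer hr i τ⟩)
    (hψ : ∀ i τ, ψ i τ = red ⟨(r'.conj g').diagEntry i τ, diagEntry_mem_integer hr' i τ⟩)
    (hinj : Function.Injective χ) :
    (∃ τ, ‖(r'.conj g').diagEntry 0 τ - (r'.conj g').diagEntry 1 τ‖ = 1) ∧
      ∃ τ, ‖(r'.conj g').diagEntry 2 τ - (r'.conj g').diagEntry 3 τ‖ = 1 := by
  have hψinj := (MonoidHom.injective_of_sum_eq χ ψ hinj
    (sum_resDiagChar_eq_of_congr red hr hr' hcong hχ hψ)).1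
  exact ⟨(resDiagChar_ne_iff hr' red hψ 0 1).1 fun h01 => absurd (hψinj h01) (by decide),
    (resDiagChar_ne_iff hr' red hψ 2 3).1 fun h23 => absurd (hψinj h23) (by decide)⟩

/-! ## Part III — Stub 1b itself (registered signature, verbatim) -/

open Field IsDedekindDomain
open scoped NumberField

/-- The equal-weight pairs `i < j` of the Yoshida shape `(0,0,1,1)` are `(0,1)` and `(2,3)`. [folklore] -/
theorem yoshida4Shape_lt_eq_iff' (i j : Fin 4) (hij : i < j) :
    (![0, 0, 1, 1] : Fin 4 → ℕ) i = ![0, 0, 1, 1] j ↔ i = 0 ∧ j = 1 ∨ i = 2 ∧ j = 3 := by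
  revert i j
  decide

/-- For `p ≠ 2`: `‖(-1 : ℚ̄_p) - 1‖ = 1` (`= ‖2‖_p`). [folklore] -/
theorem norm_neg_one_sub_one_eq_one {p : ℕ} [Fact p.Prime] (hp : p ≠ 2) :
    ‖(-1 : PadicAlgCl p) - 1‖ = 1 := by
  have h2 : ‖(2 : ℚ_[p])‖ = 1 := by
    have hle : ‖((2 : ℤ) : ℚ_[p])‖ ≤ 1 := Padic.norm_int_le_one 2
    have hnlt : ¬ ‖((2 : ℤ) : ℚ_[p])‖ < 1 := by
      rw [Padic.norm_intCast_lt_one_iff]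
      intro hdvd
      have hp2 : p ∣ 2 := by exact_mod_cast hdvd
      exact hp ((Nat.prime_dvd_prime_iff_eq Fact.out Nat.prime_two).1 hp2)
    have := le_antisymm hle (not_lt.1 hnlt)
    simpa using this
  have : (-1 : PadicAlgCl p) - 1 = -(algebraMap ℚ_[p] (PadicAlgCl p) 2) := by
    rw [map_ofNat]; norm_num
  rw [this, norm_neg, norm_algebraMap', h2]

/-- **Stub 1b (`stub_distinguishedTransferLocal`) — candidate proof (drefute gen-4 route: trace
congruence + Dedekind independence; no Brauer–Nesbitt).**  Let `p` be odd, `v ∣ p`, and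
`r, r' : Γ_ℚ → GL₄(ℚ̄_p)` with congruent characteristic polynomials everywhere (conclusion of Stub 1a).
If `r` is residually distinguished of shape `(0,0,1,1)` at `v` and `r'` is Greenberg-ordinary of shape
`(0,0,1,1)` at `v`, then `r'` is residually distinguished of shape `(0,0,1,1)` at `v` — in its
Greenberg frame.  Proof: the four residual diagonal characters `χ̄ᵢ` of `r` (distinguished frame) are
pairwise distinct (`χ̄₀ ≠ χ̄₁`, `χ̄₂ ≠ χ̄₃` by hypothesis; cross-block at an inertia element `ι` with
`ε(ι) = -1`, `‖-1 - 1‖ = 1` as `p ≠ 2`); the `X³`-coefficients of the congruence give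
`Σ χ̄ᵢ = Σ ψ̄ᵢ` pointwise on `Γ_{ℚ_v}` for the residual diagonal characters `ψ̄ᵢ` of `r'` (Greenberg
frame); Dedekind independence + counting ⇒ `ψ̄` is a permutation of `χ̄` ⇒ `ψ̄₀ ≠ ψ̄₁`, `ψ̄₂ ≠ ψ̄₃`.
[cite: BoxerEtAl2021, §7.3 (p-distinguished); SerreAbelianLadic1968, Ch. I §2.3] -/
theorem stub_distinguishedTransferLocal :
    ∀ (p : ℕ) [Fact p.Prime], p ≠ 2 → ∀ (k : Type) [Field k] [CharP k p]
      (red : Valued.integer (PadicAlgCl p) →+* k)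
      (r r' : FramedGaloisRep ℚ (PadicAlgCl p) 4) (v : HeightOneSpectrum (𝓞 ℚ)),
      ((p : ℕ) : 𝓞 ℚ) ∈ v.asIdeal →
      (∀ τ : Field.absoluteGaloisGroup ℚ,
        ∃ P P' : Polynomial (Valued.integer (PadicAlgCl p)),
          P.map (Valued.integer (PadicAlgCl p)).subtype = FramedRep.charpoly r τ ∧
          P'.map (Valued.integer (PadicAlgCl p)).subtype = FramedRep.charpoly r' τ ∧
          P.map red = P'.map red) →
      r.IsResiduallyDistinguishedAt v ![0, 0, 1, 1] →
      r'.IsGreenbergOrdinaryOfShapeAt v ![0, 0, 1, 1] →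
      r'.IsResiduallyDistinguishedAt v ![0, 0, 1, 1] := by
  intro p _ hp k _ _ red r r' v hv hcong hdist hGr
  haveI : CompactSpace (absoluteGaloisGroup (v.adicCompletion ℚ)) :=
    absoluteGaloisGroup_compactSpace _
  obtain ⟨g, htri, hdiag, hwit⟩ :=
    (FramedRep.isResiduallyDistinguishedOfShape_iff_conj (r.toLocal v) ![0, 0, 1, 1]).1 hdist
  obtain ⟨g', htri', hdiag', -⟩ :=
    (FramedRep.isGreenbergOrdinaryOfShape_iff_conj (r'.toLocal v) ![0, 0, 1, 1]).1 hGr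
  have hcongL : ∀ τ : absoluteGaloisGroup (v.adicCompletion ℚ),
      ∃ P P' : Polynomial (Valued.integer (PadicAlgCl p)),
        P.map (Valued.integer (PadicAlgCl p)).subtype = (r.toLocal v).charpoly τ ∧
        P'.map (Valued.integer (PadicAlgCl p)).subtype = (r'.toLocal v).charpoly τ ∧
        P.map red = P'.map red :=
    fun τ => hcong (absGaloisRestrict ℚ (v.adicCompletion ℚ) τ)
  have hvp : (Rat.HeightOneSpectrum.primesEquiv v : ℕ) = p :=
    Literature.NumberTheory.EllipticCurves.primesEquiv_eq_of_natCast_mem Fact.out hv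
  obtain ⟨ι, hιI, hιε⟩ :=
    adicCompletion_rat_exists_mem_absInertia_cyclotomicCharacter_eq p v hvp (-1)
  have hu : algebraMap ℚ_[p] (PadicAlgCl p)
      ((((GaloisRep.cyclotomicCharacter (v.adicCompletion ℚ) p ι)⁻¹ : ℤ_[p]ˣ) : ℤ_[p]) : ℚ_[p])
        = -1 := by
    rw [hιε, inv_neg_one, Units.val_neg, Units.val_one, PadicInt.coe_neg, PadicInt.coe_one,
      map_neg, map_one]
  have hs0 : (![0, 0, 1, 1] : Fin 4 → ℕ) 0 = 0 := rfl; have hs1 : (![0, 0, 1, 1] : Fin 4 → ℕ) 1 = 0 := rfl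
  have hs2 : (![0, 0, 1, 1] : Fin 4 → ℕ) 2 = 1 := rfl; have hs3 : (![0, 0, 1, 1] : Fin 4 → ℕ) 3 = 1 := rfl
  obtain ⟨χ, hχ⟩ := exists_resDiagChar htri red
  obtain ⟨ψ, hψ⟩ := exists_resDiagChar htri' red
  have hinj : Function.Injective χ := by
    refine injective_resDiagChar_of_yoshida htri red hχ (hwit 0 1 (by decide) (by decide))
      (hwit 2 3 (by decide) (by decide)) ⟨ι, -1, ?_, ?_, ?_, ?_, norm_neg_one_sub_one_eq_one hp⟩
    · have := hdiag ι hιI 0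
      rwa [hs0, pow_zero] at this
    · have := hdiag ι hιI 1
      rwa [hs1, pow_zero] at this
    · have := hdiag ι hιI 2
      rwa [hs2, pow_one, hu] at this
    · have := hdiag ι hιI 3
      rwa [hs3, pow_one, hu] at this
  obtain ⟨h01, h23⟩ :=
    residuallyDistinguished_transfer_core red htri htri' hcongL hχ hψ hinj
  refine (FramedRep.isResiduallyDistinguishedOfShape_iff_conj (r'.toLocal v) ![0, 0, 1, 1]).2
    ⟨g', htri', hdiag', fun i j hij hij' => ?_⟩
  rcases (yoshida4Shape_lt_eq_iff' i j hij).1 hij' with ⟨rfl, rfl⟩ | ⟨rfl, rfl⟩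
  exacts [h01, h23]

end Summit.Langlands.Langlands.Cruxes.StableYoshidaCongruence.LevelThreeWeierstrassSwitch
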